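import Summits.SmoothPoincare4.SmoothPoincare4.Theorems.ConvexBisectionAcyclicBisectionExistsComplementPieceExists
import Summits.SmoothPoincare4.SmoothPoincare4.Theorems.ConvexBisectionAcyclicBisectionExistsDualHandleModelEmbedding
import Summits.SmoothPoincare4.SmoothPoincare4.Theorems.ConvexBisectionAcyclicBisectionExistsDualHandleModelBoundary
import Summits.SmoothPoincare4.SmoothPoincare4.Theorems.ConvexBisectionAcyclicBisectionExistsDualHandleSeamModelDual
import HarnessLib

/-!
# The dual multi-attachment data, I: the glued handle chart on the image of the model map
(helper file 1 of the wave-5 brick T3b (iv) "the dual multi-attachment data `D₂` on the complement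
piece `W₂`" for stub `stub_T3_dualPresentation` (T3), line `modp-braid-orbits`, crux
`ConvexBisection.AcyclicBisectionExists`, item stmt-SmoothPoincare4-10508; lead c5, worker X1)

Setting (V5-REPORT §3, Y6-REPORT §3b): `M' = X ∪_Ψ W = G.d₂.Glued` Milnor's gluing in standard form,
`Θᵢ = gluedHandleChart D i G a` the glued handle chart of the `i`-th handle (Y6, file IIb: the open
handle on the open unit ball, the seam chart `modelChart` on the seam zone), `𝓕 = modelF a κ δ` the
model of the dual handle embedding (V5/Z1/Z2: an open smooth embedding of the embedding domain
`Ω = {s < 1, u < 1 + 1/(2(a+1))}` with image of the punctured closed ball `Dome ∪ N`).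

* §1 complements on the glued chart: images of open subsets of `chartDom a` are open
  (`isOpen_image_gluedHandleChart`), `Θᵢ` is an immersion at every point of `chartDom a`
  (`isImmersionAt_gluedHandleChart`).
* §2 **`Dome ∪ N ⊆ chartDom a`** under the smallness `a δ ≤ 1/5` (the domes lie in the seam zone),
  the `W`-side points of `Dome ∪ N` are dual vectors `dualVec a κ δ y` (`exists_dualVec_eq_of_one_le_norm`).
* §3 **the composite `Θᵢ ∘ 𝓕`** on the open set `Ω ∩ 𝓕⁻¹(chartDom a)` (which contains the punctured
  closed ball): smooth, injective, open, an immersion at every point.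

Everything here is proved; no named facts, no definitions.

## References
* J. Milnor, *Lectures on the h-cobordism theorem* (1965), §3 (dual handles). [MilnorHCobordism1965]
* A. A. Kosinski, *Differential Manifolds* (1993), VI §6. [Kosinski1993]
* J. M. Lee, *Introduction to Smooth Manifolds* (2013), Thm. 4.14, Prop. 5.22. [LeeSmoothManifolds2013]
-/

noncomputable section

-- the prescribed namespace `Summit.<P>.<Sub>.…` duplicates `SmoothPoincare4` (P = Sub)
set_option linter.dupNamespace false

open scoped Manifold ContDiff Topology

namespace Summit.SmoothPoincare4.SmoothPoincare4.Theorems.AcyclicBisectionExists.ModpBraidOrbits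

open Set Function Metric Filter Topology
open Literature.Topology.FourManifolds Literature.Topology.FourManifolds.HandleAttachingMap

/-! ### §1 Complements on the glued handle chart -/

section Chart

variable {B : Type} [TopologicalSpace B] [T2Space B] [ChartedSpace (EuclideanHalfSpace 4) B]
  {ι : Type} [Finite ι] {h : ι → HandleAttachingMap 3 2 B}
  {X : Type} [TopologicalSpace X] [ChartedSpace (EuclideanHalfSpace 4) X] [IsManifold (𝓡∂ 4) ∞ X]
  (D : MultiAttachmentData h (𝓡∂ 4) X) (i : ι) {bX : BoundaryData (𝓡∂ 4) X (𝓡 3)}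
  {W : Type} [TopologicalSpace W] [ChartedSpace (EuclideanHalfSpace 4) W]
  [IsManifold (𝓡∂ 4) ∞ W] {bW : BoundaryData (𝓡∂ 4) W (𝓡 3)} [Nonempty bX.carrier]
  (G : BoundaryGlueData bX bW) {a : ℝ} [CompactSpace X] [T2Space X] [T2Space W]

/-- The inverse of the coercion partial homeomorphism of an open subset, on a point of the subset.
[folklore] -/
theorem opens_symm_apply_of_mem {Y : Type*} [TopologicalSpace Y] (U : TopologicalSpace.Opens Y)
    (hne : Nonempty U) {y : Y} (hy : y ∈ U) : (U.openPartialHomeomorphSubtypeCoe hne).symm y = ⟨y, hy⟩ := by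
  have := (U.openPartialHomeomorphSubtypeCoe hne).left_inv
    (show (⟨y, hy⟩ : U) ∈ (U.openPartialHomeomorphSubtypeCoe hne).source by
      rw [TopologicalSpace.Opens.openPartialHomeomorphSubtypeCoe_source]; exact mem_univ _)
  rwa [TopologicalSpace.Opens.openPartialHomeomorphSubtypeCoe_coe] at this

/-- **An immersion of an open subset, read on the ambient manifold**: if `F ∘ Subtype.val : U → N` is an
immersion at `⟨x, hx⟩` for an open `U ∋ x`, then `F` is an immersion at `x`. [cite: LeeSmoothManifolds2013, Prop. 5.22] -/
theorem isImmersionAt_of_opens {Y : Type*} [TopologicalSpace Y] [ChartedSpace (EuclideanSpace ℝ (Fin 4)) Y]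
    [IsManifold (𝓡 4) ∞ Y] {N : Type*} [TopologicalSpace N] [ChartedSpace (EuclideanSpace ℝ (Fin 4)) N]
    {F : Y → N} (U : TopologicalSpace.Opens Y) {x : Y} (hx : x ∈ U)
    (hF : Manifold.IsImmersionAt (𝓡 4) (𝓡 4) ∞ (fun y : U => F y) ⟨x, hx⟩) :
    Manifold.IsImmersionAt (𝓡 4) (𝓡 4) ∞ F x := by
  haveI hne : Nonempty U := ⟨⟨x, hx⟩⟩
  set c := U.openPartialHomeomorphSubtypeCoe hne with hc
  have hΦ : ContMDiffOn (𝓡 4) (𝓡 4) ∞ c.symm c.symm.source := contMDiffOn_openPartialHomeomorphSubtypeCoe_symm _ hne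
  have hΦ' : ContMDiffOn (𝓡 4) (𝓡 4) ∞ c.symm.symm c.symm.target := by
    rw [OpenPartialHomeomorph.symm_symm, OpenPartialHomeomorph.symm_target]
    exact contMDiffOn_openPartialHomeomorphSubtypeCoe _ hne
  have hsrc : x ∈ c.symm.source := by
    rw [OpenPartialHomeomorph.symm_source, TopologicalSpace.Opens.openPartialHomeomorphSubtypeCoe_target]; exact hx
  have hcx : c.symm x = ⟨x, hx⟩ := opens_symm_apply_of_mem U hne hx
  have h1 : Manifold.IsImmersionAtOfComplement hF.complement (𝓡 4) (𝓡 4) ∞ (fun y : U => F y) (c.symm x) := by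
    rw [hcx]; exact hF.isImmersionAtOfComplement_complement
  have h2 := (h1.comp_openPartialHomeomorph c.symm hΦ hΦ' hsrc).isImmersionAt
  refine h2.congr_of_eventuallyEq ?_
  filter_upwards [U.isOpen.mem_nhds hx] with y hy
  show F ((c.symm y : U) : Y) = F y
  rw [hc, opens_symm_apply_of_mem U hne hy]

/-- **Images of open subsets of the chart domain under the glued chart are open** (the glued chart is,
around every point of `chartDom a`, a smooth embedding with open range of an open set, and it is
injective on `chartDom a`). [cite: LeeSmoothManifolds2013, Thm. 4.14] -/
theorem isOpen_image_gluedHandleChart (ha : 0 < a) (hCM : CollarAdapted D i G a)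
    {O : Set (EuclideanSpace ℝ (Fin 4))} (hO : IsOpen O) (hOV : O ⊆ chartDom a) :
    IsOpen (gluedHandleChart D i G a '' O) := by
  rw [isOpen_iff_forall_mem_open]
  rintro _ ⟨x, hx, rfl⟩
  obtain ⟨U, hxU, hUV, hemb, hopen⟩ := exists_isSmoothEmbedding_gluedHandleChart D i G ha hCM (hOV hx)
  have hk : IsOpenEmbedding (fun y : U => gluedHandleChart D i G a y) := ⟨hemb.isEmbedding, hopen⟩
  -- the image of the open subset `O ∩ U` of `U`
  have h1 : IsOpen ((fun y : U => gluedHandleChart D i G a y) '' (Subtype.val ⁻¹' O)) :=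
    hk.isOpenMap _ (hO.preimage continuous_subtype_val)
  refine ⟨_, ?_, h1, ⟨⟨x, hxU⟩, hx, rfl⟩⟩
  rintro _ ⟨y, hy, rfl⟩
  exact ⟨y, hy, rfl⟩

/-- **The glued chart is an immersion at every point of the chart domain.**
[cite: LeeSmoothManifolds2013, Prop. 5.22] -/
theorem isImmersionAt_gluedHandleChart (ha : 0 < a) (hCM : CollarAdapted D i G a)
    {x : EuclideanSpace ℝ (Fin 4)} (hx : x ∈ chartDom a) :
    Manifold.IsImmersionAt (𝓡 4) (𝓡 4) ∞ (gluedHandleChart D i G a) x := by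
  obtain ⟨U, hxU, -, hemb, -⟩ := exists_isSmoothEmbedding_gluedHandleChart D i G ha hCM hx
  exact isImmersionAt_of_opens U hxU (hemb.isImmersion.isImmersionAt ⟨x, hxU⟩)

end Chart

/-! ### §2 The image `Dome ∪ N` of the model map lies in the chart domain -/

section Image

variable {a κ δ : ℝ}

/-- `g a δ ≤ a δ` for `δ ≤ 1/2` (`0 < a`, `0 ≤ δ`). [folklore] -/
theorem gProfile_le_mul (ha : 0 < a) (hδ : 0 ≤ δ) (hδ2 : δ ≤ 1 / 2) : gProfile a δ ≤ a * δ := by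
  unfold gProfile
  rw [div_le_iff₀ (by linarith)]
  nlinarith [mul_nonneg ha.le hδ]

/-- **The dome lies in the seam zone** when `a δ ≤ 1/5` (its `W`-depth `‖x‖² - 1 < g a δ ≤ a δ`).
[cite: MilnorHCobordism1965, §3] -/
theorem dualDome_subset_seamZone (ha : 0 < a) (hκ : 0 < κ) (hκ2 : κ ≤ 1 / 2) (hδ : 0 < δ) (hδ2 : δ ≤ 1 / 2)
    (haδ : a * δ ≤ 1 / 5) : dualDome a κ δ ⊆ seamZone a := by
  intro x hx
  obtain ⟨hP, h1, h2⟩ := hx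
  have hκsq : κ ^ 2 ≤ 1 / 4 := by nlinarith
  have hsum := norm_sq_eq_lamPart_muPart x
  refine ⟨?_, ?_, ?_⟩
  · intro h0
    rw [h0, norm_zero] at hsum
    nlinarith
  · nlinarith [norm_nonneg (lamPart x)]
  · rw [abs_sub_comm, abs_of_nonneg (by linarith)]
    have h0 : 0 ≤ ‖lamPart x‖ ^ 2 / κ ^ 2 := by positivity
    have ht1 : δ * (1 - ‖lamPart x‖ ^ 2 / κ ^ 2) ≤ δ := by nlinarith
    have hg1 : gProfile a (δ * (1 - ‖lamPart x‖ ^ 2 / κ ^ 2)) ≤ gProfile a δ :=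
      gProfile_le_gProfile ha ht1 (by linarith)
    have hg2 := gProfile_le_mul ha hδ.le hδ2
    have h3 : a * δ ≤ min (1 / 5) a := le_min haδ (by nlinarith)
    exact lt_of_lt_of_le (by linarith) h3

/-- **The cocore neighbourhood lies in the chart domain** (interior points in the open ball, its sphere
points `‖x_λ‖² ≤ 3κ²/4` in the seam zone). [cite: MilnorHCobordism1965, §3] -/
theorem cocoreNbhd_subset_chartDom (ha : 0 < a) (hκ : 0 < κ) (hκ2 : κ ≤ 1 / 2) (hδ : 0 < δ) :
    cocoreNbhd κ δ ⊆ chartDom a := by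
  intro x hx
  have h1 : ‖x‖ ≤ 1 := hx.1
  rcases h1.lt_or_eq with h1 | h1
  · exact Or.inl (mem_ball_zero_iff.2 h1)
  · right
    have hP := lamSq_le_of_mem_cocoreNbhd hδ hx
    have hκsq : κ ^ 2 ≤ 1 / 4 := by nlinarith
    have hsum := norm_sq_eq_lamPart_muPart x
    refine ⟨?_, ?_, ?_⟩
    · intro h0
      rw [h0, norm_zero, h1] at hsum
      nlinarith
    · nlinarith [norm_nonneg (lamPart x)]
    · rw [h1, one_pow, sub_self, abs_zero]
      exact lt_min (by norm_num) ha

/-- **`Dome ∪ N ⊆ chartDom a`.** [cite: MilnorHCobordism1965, §3] -/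
theorem dualDome_union_cocoreNbhd_subset_chartDom (ha : 0 < a) (hκ : 0 < κ) (hκ2 : κ ≤ 1 / 2) (hδ : 0 < δ)
    (hδ2 : δ ≤ 1 / 2) (haδ : a * δ ≤ 1 / 5) : dualDome a κ δ ∪ cocoreNbhd κ δ ⊆ chartDom a :=
  union_subset ((dualDome_subset_seamZone ha hκ hκ2 hδ hδ2 haδ).trans subset_union_right)
    (cocoreNbhd_subset_chartDom ha hκ hκ2 hδ)

/-- The model map sends the punctured closed ball into the chart domain. [cite: MilnorHCobordism1965, §3] -/
theorem modelF_mem_chartDom (ha : 0 < a) (hκ : 0 < κ) (hκ2 : κ ≤ 1 / 2) (hδ : 0 < δ) (hδ2 : δ ≤ 1 / 2)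
    (haδ : a * δ ≤ 1 / 5) {z : EuclideanSpace ℝ (Fin 4)} (hz : ‖z‖ ≤ 1) (hs : sOf z < 1) :
    modelF a κ δ z ∈ dualDome a κ δ ∪ cocoreNbhd κ δ ∧ modelF a κ δ z ∈ chartDom a := by
  have h : modelF a κ δ z ∈ dualDome a κ δ ∪ cocoreNbhd κ δ := by
    rw [← image_modelF_eq ha hκ hκ2 hδ hδ2]
    exact mem_image_of_mem _ ⟨hz, hs⟩
  exact ⟨h, dualDome_union_cocoreNbhd_subset_chartDom ha hκ hκ2 hδ hδ2 haδ h⟩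

/-- **The `W`-side points of `Dome ∪ N` are dual vectors**: for `1 ≤ ‖x‖` such a point is in the dome
(sphere points of `N` have `‖x_λ‖² ≤ 3κ²/4 < κ²`), and `Dome = range (dualVec a κ δ)` (Z2).
[cite: MilnorHCobordism1965, §3] -/
theorem exists_dualVec_eq_of_one_le_norm (ha : 0 < a) (hκ : 0 < κ) (hκ2 : κ ≤ 1 / 2) (hδ : 0 < δ)
    (hδ2 : δ ≤ 1 / 2) {x : EuclideanSpace ℝ (Fin 4)} (hx : x ∈ dualDome a κ δ ∪ cocoreNbhd κ δ) (h1 : 1 ≤ ‖x‖) :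
    ∃ y : ↥(handleTube 3 2), dualVec a κ δ y = x := by
  have hxD : x ∈ dualDome a κ δ := by
    rcases hx with hx | hx
    · exact hx
    · have hn : ‖x‖ = 1 := le_antisymm hx.1 h1
      have hP := lamSq_le_of_mem_cocoreNbhd hδ hx
      have hκ0 : 0 < κ ^ 2 := by positivity
      have hlt : ‖lamPart x‖ ^ 2 / κ ^ 2 < 1 := by
        rw [div_lt_one hκ0]; nlinarith
      have h0 : 0 ≤ ‖lamPart x‖ ^ 2 / κ ^ 2 := by positivity
      have hg : 0 < gProfile a (δ * (1 - ‖lamPart x‖ ^ 2 / κ ^ 2)) :=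
        gProfile_pos ha (mul_pos hδ (by linarith)) (by nlinarith)
      refine ⟨by nlinarith, by rw [hn]; norm_num, ?_⟩
      rw [hn, one_pow]
      linarith
  rwa [dualDome_eq_range_dualVec ha hκ hκ2 hδ hδ2] at hxD

variable {B : Type} [TopologicalSpace B] [T2Space B] [ChartedSpace (EuclideanHalfSpace 4) B]
  {ι : Type} [Finite ι] {h : ι → HandleAttachingMap 3 2 B}
  {X : Type} [TopologicalSpace X] [ChartedSpace (EuclideanHalfSpace 4) X] [IsManifold (𝓡∂ 4) ∞ X]
  (D : MultiAttachmentData h (𝓡∂ 4) X) (i : ι) {ι' : Type} (f : ι' → ι) {bX : BoundaryData (𝓡∂ 4) X (𝓡 3)}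
  {W : Type} [TopologicalSpace W] [ChartedSpace (EuclideanHalfSpace 4) W]
  [IsManifold (𝓡∂ 4) ∞ W] {bW : BoundaryData (𝓡∂ 4) W (𝓡 3)} [Nonempty bX.carrier]
  (G : BoundaryGlueData bX bW)

/-- **The glued chart at a dual vector is the dual attaching map**: `Θᵢ (dualVec y) = j_N (dualMap … i y)`
(`‖dualVec y‖ ≥ 1`, so the glued chart is the model chart; V5 `jN_dualMap_eq_modelChart`).
[cite: MilnorHCobordism1965, §3] -/
theorem gluedHandleChart_dualVec (ha : 0 < a) (hκ : 0 < κ) (hκ1 : κ ≤ 1) (hδ : 0 < δ) (hδ2 : δ ≤ 1 / 2)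
    (col : (BoundaryManifold.boundaryData 3 W).Collar)
    (hcol : ∀ (w : (BoundaryManifold.boundaryData 3 W).carrier) (x : bW.carrier),
      (BoundaryManifold.boundaryData 3 W).incl w = bW.incl x →
      ∀ t : Set.Icc (0 : ℝ) 1, col.toFun (w, t) = G.CN.toFun x ((t : ℝ) / (2 - t)))
    (y : ↥(handleTube 3 2)) :
    gluedHandleChart D i G a (dualVec a κ δ y) = G.jN ((dualMap D bX bW G.φ col κ δ hκ hκ1 hδ hδ2 i).toFun y) := by
  rw [gluedHandleChart_of_one_le_norm D i G a (one_le_norm_dualVec ha hκ hκ1 hδ hδ2 y),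
    jN_dualMap_eq_modelChart D i G ha hκ hκ1 hδ hδ2 col hcol y]

/-- **The glued charts of the suffix handles send `Dome ∪ N` into the complement piece `{Φ ≤ 0}`**
(`W`-side points are `j_N` of dual-tube points, `Φ ∘ j_N ≤ 0`; ball points `x ∈ N` are handle points
`j_M (D.jB (f j) b)` with `modelH κ δ x ≤ 0`). [cite: Milnor1963, Thm. 3.1] -/
theorem levelFn_gluedHandleChart_nonpos [CompactSpace X] [T2Space X] [T2Space W] [CompactSpace W]
    (ha : 0 < a) (hf : Injective f) (hCM : ∀ j, CollarAdapted D (f j) G a)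
    (hκ : 0 < κ) (hκ2 : κ ≤ 1 / 2) (hκ1 : κ ≤ 1) (hδ : 0 < δ) (hδ2 : δ ≤ 1 / 2)
    (col : (BoundaryManifold.boundaryData 3 W).Collar)
    (hcol : ∀ (w : (BoundaryManifold.boundaryData 3 W).carrier) (x : bW.carrier),
      (BoundaryManifold.boundaryData 3 W).incl w = bW.incl x →
      ∀ t : Set.Icc (0 : ℝ) 1, col.toFun (w, t) = G.CN.toFun x ((t : ℝ) / (2 - t)))
    (j : ι') {x : EuclideanSpace ℝ (Fin 4)} (hx : x ∈ dualDome a κ δ ∪ cocoreNbhd κ δ) :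
    levelFn D f G a κ δ (gluedHandleChart D (f j) G a x) ≤ 0 := by
  by_cases h1 : 1 ≤ ‖x‖
  · obtain ⟨y, rfl⟩ := exists_dualVec_eq_of_one_le_norm ha hκ hκ2 hδ hδ2 hx h1
    rw [gluedHandleChart_dualVec D (f j) G ha hκ hκ1 hδ hδ2 col hcol y]
    exact levelFn_jN_nonpos D f G ha hf hCM hκ hκ2 hδ hδ2 _
  · push Not at h1
    have hxN : x ∈ cocoreNbhd κ δ := by
      refine hx.resolve_left fun hD => ?_
      have := hD.2.1
      nlinarith [norm_nonneg x]
    rw [gluedHandleChart_of_norm_lt_one D (f j) G a h1, levelFn_jM_jB_nonpos_iff D f G ha hf hCM hκ hκ2 hδ hδ2]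
    left
    rw [coe_beltBallPt h1]
    exact modelH_nonpos_of_mem_cocoreNbhd hκ hκ2 hδ hδ2 hxN

end Image

/-! ### §3 The composite `Θᵢ ∘ 𝓕` on the open set `Ω ∩ 𝓕⁻¹(chartDom a)` -/

section Composite

variable {B : Type} [TopologicalSpace B] [T2Space B] [ChartedSpace (EuclideanHalfSpace 4) B]
  {ι : Type} [Finite ι] {h : ι → HandleAttachingMap 3 2 B}
  {X : Type} [TopologicalSpace X] [ChartedSpace (EuclideanHalfSpace 4) X] [IsManifold (𝓡∂ 4) ∞ X]
  (D : MultiAttachmentData h (𝓡∂ 4) X) (i : ι) {bX : BoundaryData (𝓡∂ 4) X (𝓡 3)}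
  {W : Type} [TopologicalSpace W] [ChartedSpace (EuclideanHalfSpace 4) W]
  [IsManifold (𝓡∂ 4) ∞ W] {bW : BoundaryData (𝓡∂ 4) W (𝓡 3)} [Nonempty bX.carrier]
  (G : BoundaryGlueData bX bW) {a κ δ : ℝ}

/-- **The domain `Ω ∩ 𝓕⁻¹(chartDom a)` of the composite is open.** [folklore] -/
theorem isOpen_compDom (a : ℝ) (hκ : 0 < κ) (hκ2 : κ ≤ 1 / 2) (hδ : 0 < δ) (hδ2 : δ ≤ 1 / 2) (ha : 0 < a) :
    IsOpen ({z : EuclideanSpace ℝ (Fin 4) | sOf z < 1 ∧ uOf z < 1 + 1 / (2 * (a + 1))} ∩ modelF a κ δ ⁻¹' chartDom a) :=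
  (contDiffOn_modelF_embDom ha hκ hκ2 hδ hδ2).continuousOn.isOpen_inter_preimage (isOpen_embDom a) (isOpen_chartDom a)

/-- **The punctured closed ball lies in the domain of the composite** (`a δ ≤ 1/5`). [cite: MilnorHCobordism1965, §3] -/
theorem mem_compDom_of_norm_le_one (ha : 0 < a) (hκ : 0 < κ) (hκ2 : κ ≤ 1 / 2) (hδ : 0 < δ) (hδ2 : δ ≤ 1 / 2)
    (haδ : a * δ ≤ 1 / 5) {z : EuclideanSpace ℝ (Fin 4)} (hz : ‖z‖ ≤ 1) (hs : sOf z < 1) :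
    z ∈ {z : EuclideanSpace ℝ (Fin 4) | sOf z < 1 ∧ uOf z < 1 + 1 / (2 * (a + 1))} ∩ modelF a κ δ ⁻¹' chartDom a :=
  ⟨mem_embDom_of_norm_le_one ha hz hs, (modelF_mem_chartDom ha hκ hκ2 hδ hδ2 haδ hz hs).2⟩

variable [CompactSpace X] [T2Space X] [T2Space W]

/-- **The composite `Θᵢ ∘ 𝓕` is smooth on its domain.** [folklore] -/
theorem contMDiffOn_comp_modelF (ha : 0 < a) (hCM : CollarAdapted D i G a) (hκ : 0 < κ) (hκ2 : κ ≤ 1 / 2)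
    (hδ : 0 < δ) (hδ2 : δ ≤ 1 / 2) :
    ContMDiffOn (𝓡 4) (𝓡 4) ∞ (fun z => gluedHandleChart D i G a (modelF a κ δ z))
      ({z : EuclideanSpace ℝ (Fin 4) | sOf z < 1 ∧ uOf z < 1 + 1 / (2 * (a + 1))} ∩ modelF a κ δ ⁻¹' chartDom a) :=
  (contMDiffOn_gluedHandleChart D i G ha hCM).comp
    ((contDiffOn_modelF_embDom ha hκ hκ2 hδ hδ2).contMDiffOn.mono inter_subset_left) fun _ hz => hz.2

omit [CompactSpace X] [T2Space X] [T2Space W] in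
/-- **The composite is injective on its domain** (both factors are). [cite: MilnorHCobordism1965, §3] -/
theorem injOn_comp_modelF (ha : 0 < a) (hCM : CollarAdapted D i G a) (hκ : 0 < κ) (hκ2 : κ ≤ 1 / 2)
    (hδ : 0 < δ) (hδ2 : δ ≤ 1 / 2) :
    InjOn (fun z => gluedHandleChart D i G a (modelF a κ δ z))
      ({z : EuclideanSpace ℝ (Fin 4) | sOf z < 1 ∧ uOf z < 1 + 1 / (2 * (a + 1))} ∩ modelF a κ δ ⁻¹' chartDom a) :=
  fun _ hz _ hz' heq =>
    injOn_modelF_embDom ha hκ hκ2 hδ hδ2 hz.1 hz'.1 (injOn_gluedHandleChart D i G ha hCM hz.2 hz'.2 heq)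

/-- **The composite is open on its domain**: images of open subsets are open. [cite: LeeSmoothManifolds2013, Thm. 4.14] -/
theorem isOpen_image_comp_modelF (ha : 0 < a) (hCM : CollarAdapted D i G a) (hκ : 0 < κ) (hκ2 : κ ≤ 1 / 2)
    (hδ : 0 < δ) (hδ2 : δ ≤ 1 / 2) {O : Set (EuclideanSpace ℝ (Fin 4))} (hO : IsOpen O)
    (hOV : O ⊆ {z : EuclideanSpace ℝ (Fin 4) | sOf z < 1 ∧ uOf z < 1 + 1 / (2 * (a + 1))} ∩ modelF a κ δ ⁻¹' chartDom a) :
    IsOpen ((fun z => gluedHandleChart D i G a (modelF a κ δ z)) '' O) := by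
  rw [← image_image]
  exact isOpen_image_gluedHandleChart D i G ha hCM (isOpen_image_modelF ha hκ hκ2 hδ hδ2 hO fun z hz => (hOV hz).1)
    (by rintro _ ⟨z, hz, rfl⟩; exact (hOV hz).2)

/-- **The composite is an immersion at every point of its domain** (`𝓕` is a partial diffeomorphism of
`ℝ⁴` there, the glued chart an immersion at the image). [cite: LeeSmoothManifolds2013, Prop. 5.22] -/
theorem isImmersionAt_comp_modelF (ha : 0 < a) (hCM : CollarAdapted D i G a) (hκ : 0 < κ) (hκ2 : κ ≤ 1 / 2)
    (hδ : 0 < δ) (hδ2 : δ ≤ 1 / 2) {z : EuclideanSpace ℝ (Fin 4)}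
    (hz : z ∈ {z : EuclideanSpace ℝ (Fin 4) | sOf z < 1 ∧ uOf z < 1 + 1 / (2 * (a + 1))} ∩ modelF a κ δ ⁻¹' chartDom a) :
    Manifold.IsImmersionAt (𝓡 4) (𝓡 4) ∞ (fun z => gluedHandleChart D i G a (modelF a κ δ z)) z := by
  obtain ⟨Φ, hsrc, hΦ, hsm, hsymm⟩ := exists_openPartialHomeomorph_modelF ha hκ hκ2 hδ hδ2
  have hzs : z ∈ Φ.source := by rw [hsrc]; exact hz.1
  have h1 : Manifold.IsImmersionAtOfComplement (isImmersionAt_gluedHandleChart D i G ha hCM hz.2).complement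
      (𝓡 4) (𝓡 4) ∞ (gluedHandleChart D i G a) (Φ z) := by
    rw [hΦ]; exact (isImmersionAt_gluedHandleChart D i G ha hCM hz.2).isImmersionAtOfComplement_complement
  have h2 := (h1.comp_openPartialHomeomorph Φ hsm.contMDiffOn hsymm.contMDiffOn hzs).isImmersionAt
  refine h2.congr_of_eventuallyEq (Eventually.of_forall fun w => ?_)
  show gluedHandleChart D i G a (Φ w) = gluedHandleChart D i G a (modelF a κ δ w)
  rw [hΦ]

end Composite

/-! ### §4 Lifting an open embedding into a regular sublevel set -/

section Lift

variable {M' : Type*} [TopologicalSpace M'] [ChartedSpace (EuclideanSpace ℝ (Fin 4)) M'] [IsManifold (𝓡 4) ∞ M']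
  {Φ : M' → ℝ} (hΦ : IsRegularLevel (𝓡 4) Φ 0)
  {A : Type*} [TopologicalSpace A] [ChartedSpace (EuclideanHalfSpace 4) A] [IsManifold (𝓡∂ 4) ∞ A]

/-- **Lifting an embedding into the regular sublevel set `{Φ ≤ 0}`.**  Let `F : A → M'` be an injective
immersion which is a topological embedding, of a `4`-manifold with boundary into `M'`, with values in
`{Φ ≤ 0}` (`0` a regular value), and suppose the range of the lifted map `A → {Φ ≤ 0}` is open.  Then the
lifted map is a smooth embedding of manifolds with boundary: it is smooth into the regular domain
(`HalfSliceAtlas.contMDiff_codRestrict`), an open topological embedding, and its inverse on the range is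
the smooth left inverse of `F` (`contMDiffOn_leftInverse_of_isImmersion`) composed with the inclusion, so
the criterion `isSmoothEmbedding_of_contMDiffOn_symm` applies. [cite: LeeSmoothManifolds2013, Thm. 4.14] -/
theorem isSmoothEmbedding_sublevel_lift [Nonempty A] {F : A → M'} (himm : Manifold.IsImmersion (𝓡∂ 4) (𝓡 4) ∞ F)
    (hemb : IsEmbedding F) (hmem : ∀ x, Φ (F x) ≤ 0)
    (hopen : IsOpen (range fun x => RegularSublevel.mk hΦ (F x) (hmem x))) :
    Manifold.IsSmoothEmbedding (𝓡∂ 4) (𝓡∂ 4) ∞ (fun x => RegularSublevel.mk hΦ (F x) (hmem x)) := by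
  set F' : A → RegularSublevel hΦ := fun x => RegularSublevel.mk hΦ (F x) (hmem x) with hF'
  have hsm : ContMDiff (𝓡∂ 4) (𝓡∂ 4) ∞ F' :=
    (RegularSublevel.halfSliceAtlas hΦ).contMDiff_codRestrict hmem himm.contMDiff
  have hcompF : RegularSublevel.incl hΦ ∘ F' = F := rfl
  have hembF' : IsEmbedding F' := (RegularSublevel.isEmbedding_incl hΦ).of_comp_iff.1 (hcompF ▸ hemb)
  have hk : IsOpenEmbedding F' := ⟨hembF', hopen⟩
  refine isSmoothEmbedding_of_contMDiffOn_symm hk hsm ?_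
  have hinv : ContMDiffOn (𝓡 4) (𝓡∂ 4) ∞ (invFun F) (range F) :=
    contMDiffOn_leftInverse_of_isImmersion himm hemb (leftInverse_invFun hemb.injective)
  have hcomp : ContMDiffOn (𝓡∂ 4) (𝓡∂ 4) ∞ (invFun F ∘ RegularSublevel.incl hΦ) (range F') :=
    hinv.comp (RegularSublevel.contMDiff_incl hΦ).contMDiffOn (by rintro _ ⟨x, rfl⟩; exact ⟨x, rfl⟩)
  refine hcomp.congr fun p hp => ?_
  obtain ⟨x, rfl⟩ := hp
  rw [IsOpenEmbedding.toOpenPartialHomeomorph_left_inv]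
  exact (leftInverse_invFun hemb.injective x).symm

end Lift

/-- **Registered helper `helper_sublevel_lift_embedding` (brick T3b (iv), sub-goal of
`stub_T3_dualPresentation`, wave 5, lead c5): lifting an embedding into a regular sublevel set** — an
immersion `F : A → M'` of a `4`-manifold with boundary which is a topological embedding with values in
`{Φ ≤ 0}` (`0` regular) and whose lift has open range lifts to a smooth embedding `A → {Φ ≤ 0}` of
manifolds with boundary (used for the handle charts `F_j` and the stretched piece `E` of the dual
multi-attachment data on the complement piece `W₂ = {Φ ≤ 0}`). [cite: LeeSmoothManifolds2013, Thm. 4.14] -/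
theorem helper_sublevel_lift_embedding : ∀ {M' : Type} [TopologicalSpace M'] [ChartedSpace (EuclideanSpace ℝ (Fin 4)) M'] [IsManifold (𝓡 4) ∞ M'] {Φ : M' → ℝ} (hΦ : Literature.Topology.FourManifolds.IsRegularLevel (𝓡 4) Φ 0) {A : Type} [TopologicalSpace A] [ChartedSpace (EuclideanHalfSpace 4) A] [IsManifold (𝓡∂ 4) ∞ A] [Nonempty A] {F : A → M'}, Manifold.IsImmersion (𝓡∂ 4) (𝓡 4) ∞ F → Topology.IsEmbedding F → ∀ (hmem : ∀ x, Φ (F x) ≤ 0), IsOpen (Set.range fun x => Literature.Topology.FourManifolds.RegularSublevel.mk hΦ (F x) (hmem x)) → Manifold.IsSmoothEmbedding (𝓡∂ 4) (𝓡∂ 4) ∞ (fun x => Literature.Topology.FourManifolds.RegularSublevel.mk hΦ (F x) (hmem x)) :=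
  fun hΦ _ _ _ _ _ _ himm hemb hmem hopen => isSmoothEmbedding_sublevel_lift hΦ himm hemb hmem hopen

end Summit.SmoothPoincare4.SmoothPoincare4.Theorems.AcyclicBisectionExists.ModpBraidOrbits

end
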